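import Literature.Geometry.Riemannian.RicciDeTurckCoord
import Literature.Geometry.Lorentzian.MetricNormSq
import HarnessLib

/-!
# The metric square norm of a bilinear form in coordinates
(topic `Geometry/Riemannian`)

Sixth layer of the DeTurck decomposition of the named fact
`Literature.Geometry.Riemannian.ricciFlow_uniqueness` (`RicciFlow.lean`; Hamilton 1982,
Thm. 5.1; Topping 2006, Thm. 5.2.2), towards uniqueness of the Ricci–DeTurck flow (hypothesis
(RU) of `RicciDeTurckReduction.lean`; Andrews–Hopper 2011, §5.4.2, Step 1) by the maximum
principle (`MaximumPrincipleAtMaxima.lean`) applied to `u = |g₁ - g₂|²_h`, the metric square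
norm (`PseudoRiemannianMetric.normSq`, `MetricNormSq.lean`; O'Neill 1983, Ch. 3, pp. 60–61,
`|T|² = T_{ij} T^{ij}`) of the difference of the two flows with respect to the background metric
`h`. This file provides `u` in coordinates and its calculus: the coordinate expression, its
positivity and uniform coercivity, its time derivative, and the complete second spatial
derivative of `y ↦ |H(y)|²_{h(y)}` (whose coefficients `hʲⁱ(y) hᶜᵃ(y)` depend on the point).
Everything is proved; no named fact and no `sorry` is introduced.

## Contents (all proved)

* Fibre level (any vector bundle): `normSq_eq_sum_gram_inv` —
  `|T|²_g = gʲⁱ gᶜᵃ T(β_c, βᵢ) T(βₐ, βⱼ)` in any basis `β` with inverse Gram matrix `(gʲⁱ)`.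
* Calculus (`section Calculus`, scalar functions on a normed space):
  `fderiv_fderiv_apply_eq_fderiv`, `fderiv_fderiv_mul_apply`, `fderiv_fderiv_mul_mul_apply`
  (Leibniz rule for second derivatives of products of two and three functions),
  `fderiv_fderiv_fun_sum_apply`, `contDiffAt_apply₂`, `fderiv_fderiv_apply₂`.
* Data level (`section Data`, a basis `b` of `E`): `normSqCoord b Gi T T'` (the pairing
  `gʲⁱ gᶜᵃ T_{ci} T'_{aj}`), symmetry, bilinearity, homogeneity, the bound
  `|normSqCoord| ≤ normSqCoordBound ‖T‖ ‖T'‖`, the weighted version `wsum` with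
  `normSqCoord_eq_wsum`, its bound `abs_wsum_le` and bilinearity,
  **`fderiv_fderiv_wsum_apply`** (the nine-term expansion of `D²[wsum (wt y) (H y) (H y)]`:
  two terms with `D²H`, the two "good" terms `⟨DH(p), DH(q)⟩ + ⟨DH(q), DH(p)⟩`, five terms with
  derivatives on the weights), and **`hasDerivWithinAt_normSqCoord`**
  (`d/dt ⟨T_t, T_t⟩ = 2⟨T', T_t⟩`).
* On `U : Opens E` (`section Ident`): `bilinT`, **`normSq_eq_normSqCoord`**
  (`|T|²_h(x) = normSqCoord b (h⁻¹(x)) T T`, with `h⁻¹ = gramInv b (Hr x)` of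
  `RicciDeTurckCoord.lean`), `normSqCoord_self_nonneg`, `normSqCoord_self_pos` (Riemannian `h`),
  `continuousAt_gramInv_repr`, and **`exists_pos_mul_norm_sq_le_normSqCoord`** — uniform
  coercivity `μ ‖T‖² ≤ ⟨T, T⟩_{h(y)}` over a compact `K ⊆ U`.

## References

* B. O'Neill, *Semi-Riemannian geometry*, Academic Press 1983, Ch. 3, pp. 60–61 (metric
  contraction, `♯`, `T_{ij}T^{ij}`). [ONeill1983]
* B. Andrews, C. Hopper, *The Ricci flow in Riemannian geometry*, LNM 2011 (2011), §5.4.2,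
  Step 1. [AndrewsHopper2011]
-/

noncomputable section

set_option maxSynthPendingDepth 3

open Bundle Set Function Filter ContinuousLinearMap TopologicalSpace
open scoped Manifold ContDiff Topology

namespace Literature.Geometry.Riemannian

open Lorentzian Lorentzian.OpensChart Lorentzian.PseudoRiemannianMetric

/-! ### The metric pairing of bilinear forms in a basis of a fibre -/

section Fibre

variable {EB : Type*} [NormedAddCommGroup EB] [NormedSpace ℝ EB]
  {HB : Type*} [TopologicalSpace HB] {B : Type*} [TopologicalSpace B] [ChartedSpace HB B]
  {IB : ModelWithCorners ℝ EB HB} {n' : ℕ∞ω}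
  {F' : Type*} [NormedAddCommGroup F'] [NormedSpace ℝ F'] {V : B → Type*}
  [TopologicalSpace (TotalSpace F' V)] [∀ b, TopologicalSpace (V b)] [∀ b, AddCommGroup (V b)]
  [∀ b, Module ℝ (V b)] [FiberBundle F' V] [VectorBundle ℝ F' V] [FiniteDimensional ℝ F']
  {ι : Type*} [Fintype ι] [DecidableEq ι]

/-- **The metric square norm in a basis**: `|T|²_g = gʲⁱ gᶜᵃ T(β_c, βᵢ) T(βₐ, βⱼ) = Tᵢⱼ Tⁱʲ`
with `(gʲⁱ)` the inverse Gram matrix of the basis `β` (the tree's `normSq` is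
`tr ((♯ ∘ T) ∘ (♯ ∘ Tᵗ))`; expand the trace by `trace_eq_sum_gram_inv_val` and `♯` by
`sharp_eq_sum`). O'Neill 1983, Ch. 3, pp. 60–61 (metric contraction).
[cite: ONeill1983, Ch. 3, pp. 60–61] -/
theorem normSq_eq_sum_gram_inv (g' : PseudoRiemannianMetric IB n' F' V) (x : B)
    (β : Module.Basis ι ℝ (V x)) (T : LinearMap.BilinForm ℝ (V x)) :
    g'.normSq x T = ∑ i, ∑ j, ∑ a, ∑ c,
      (Matrix.of fun i j ↦ g'.val x (β i) (β j))⁻¹ j i *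
        (Matrix.of fun i j ↦ g'.val x (β i) (β j))⁻¹ c a * T (β c) (β i) * T (β a) (β j) := by
  rw [PseudoRiemannianMetric.normSq, trace_eq_sum_gram_inv_val g' x β]
  refine Finset.sum_congr rfl fun i _ ↦ Finset.sum_congr rfl fun j _ ↦ ?_
  have hval : g'.val x ((((g'.sharp x).toLinearMap ∘ₗ T) ∘ₗ ((g'.sharp x).toLinearMap ∘ₗ T.flip))
      (β i)) (β j) = ∑ a, (∑ c, (Matrix.of fun i j ↦ g'.val x (β i) (β j))⁻¹ c a * T (β c) (β i))
        * T (β a) (β j) := by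
    rw [LinearMap.comp_apply, LinearMap.comp_apply, LinearEquiv.coe_coe, val_sharp_apply,
      LinearMap.comp_apply, LinearEquiv.coe_coe, sharp_eq_sum g' x β (T.flip (β i)), map_sum,
      LinearMap.coe_sum, Finset.sum_apply]
    refine Finset.sum_congr rfl fun a _ ↦ ?_
    rw [map_smul, LinearMap.smul_apply, smul_eq_mul]
    rfl
  rw [hval, Finset.mul_sum]
  refine Finset.sum_congr rfl fun a _ ↦ ?_
  rw [Finset.sum_mul, Finset.mul_sum]
  refine Finset.sum_congr rfl fun c _ ↦ ?_
  ring

end Fibre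

/-! ### Second derivatives of products and finite sums of scalar functions -/

section Calculus

variable {E : Type*} [NormedAddCommGroup E] [NormedSpace ℝ E]

/-- At a `C²` point the derivative is differentiable. [folklore] -/
theorem differentiableAt_fderiv_of_contDiffAt_two' {f : E → ℝ} {x : E} (hf : ContDiffAt ℝ 2 f x) :
    DifferentiableAt ℝ (fderiv ℝ f) x :=
  (hf.fderiv_right (m := 1) le_rfl).differentiableAt one_ne_zero

/-- Near a `C²` point the function is differentiable. [folklore] -/
theorem eventually_differentiableAt_of_contDiffAt_two' {f : E → ℝ} {x : E}
    (hf : ContDiffAt ℝ 2 f x) : ∀ᶠ y in 𝓝 x, DifferentiableAt ℝ f y :=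
  (hf.eventually (by simp)).mono fun _ hy ↦ hy.differentiableAt (by norm_num)

/-- The second derivative applied: `D²f(x)(p, q) = ∂_p (∂_q f)(x)`. [folklore] -/
theorem fderiv_fderiv_apply_eq_fderiv {f : E → ℝ} {x : E} (hf : ContDiffAt ℝ 2 f x) (p q : E) :
    fderiv ℝ (fderiv ℝ f) x p q = fderiv ℝ (fun y ↦ fderiv ℝ f y q) x p := by
  rw [fderiv_clm_apply (differentiableAt_fderiv_of_contDiffAt_two' hf) (differentiableAt_const q)]
  simp only [fderiv_fun_const, Pi.zero_apply, ContinuousLinearMap.comp_zero, zero_add,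
    ContinuousLinearMap.flip_apply]

/-- **Second derivative of a product of two scalar functions**:
`D²(fg)(p, q) = f D²g(p, q) + g D²f(p, q) + Df(p) Dg(q) + Df(q) Dg(p)`. [folklore] -/
theorem fderiv_fderiv_mul_apply {f g : E → ℝ} {x : E} (hf : ContDiffAt ℝ 2 f x)
    (hg : ContDiffAt ℝ 2 g x) (p q : E) :
    fderiv ℝ (fderiv ℝ (fun y ↦ f y * g y)) x p q =
      f x * fderiv ℝ (fderiv ℝ g) x p q + g x * fderiv ℝ (fderiv ℝ f) x p q
        + fderiv ℝ f x p * fderiv ℝ g x q + fderiv ℝ f x q * fderiv ℝ g x p := by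
  have hfg : ContDiffAt ℝ 2 (fun y ↦ f y * g y) x := hf.mul hg
  rw [fderiv_fderiv_apply_eq_fderiv hfg, fderiv_fderiv_apply_eq_fderiv hf,
    fderiv_fderiv_apply_eq_fderiv hg]
  -- first derivatives near `x`
  have hev : (fun y ↦ fderiv ℝ (fun y ↦ f y * g y) y q) =ᶠ[𝓝 x]
      fun y ↦ f y * fderiv ℝ g y q + g y * fderiv ℝ f y q := by
    filter_upwards [eventually_differentiableAt_of_contDiffAt_two' hf,
      eventually_differentiableAt_of_contDiffAt_two' hg] with y hfy hgy
    rw [fderiv_fun_mul hfy hgy]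
    simp only [_root_.add_apply, FunLike.coe_smul, Pi.smul_apply, smul_eq_mul]
  rw [hev.fderiv_eq]
  have hf1 : DifferentiableAt ℝ f x := hf.differentiableAt two_ne_zero
  have hg1 : DifferentiableAt ℝ g x := hg.differentiableAt two_ne_zero
  have hf2 : DifferentiableAt ℝ (fun y ↦ fderiv ℝ f y q) x :=
    (differentiableAt_fderiv_of_contDiffAt_two' hf).clm_apply (differentiableAt_const q)
  have hg2 : DifferentiableAt ℝ (fun y ↦ fderiv ℝ g y q) x :=
    (differentiableAt_fderiv_of_contDiffAt_two' hg).clm_apply (differentiableAt_const q)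
  rw [fderiv_fun_add (f := fun y ↦ f y * fderiv ℝ g y q) (g := fun y ↦ g y * fderiv ℝ f y q)
    (by exact hf1.mul hg2) (by exact hg1.mul hf2), fderiv_fun_mul hf1 hg2, fderiv_fun_mul hg1 hf2]
  simp only [_root_.add_apply, FunLike.coe_smul, Pi.smul_apply, smul_eq_mul]
  ring

/-- The first derivative of a product, applied. [folklore] -/
theorem fderiv_mul_apply' {f g : E → ℝ} {x : E} (hf : DifferentiableAt ℝ f x)
    (hg : DifferentiableAt ℝ g x) (p : E) :
    fderiv ℝ (fun y ↦ f y * g y) x p = f x * fderiv ℝ g x p + g x * fderiv ℝ f x p := by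
  rw [fderiv_fun_mul hf hg]
  simp only [_root_.add_apply, FunLike.coe_smul, Pi.smul_apply, smul_eq_mul]

/-- **Second derivative of a product of three scalar functions** (the nine terms of the Leibniz
rule). [folklore] -/
theorem fderiv_fderiv_mul_mul_apply {f g h : E → ℝ} {x : E} (hf : ContDiffAt ℝ 2 f x)
    (hg : ContDiffAt ℝ 2 g x) (hh : ContDiffAt ℝ 2 h x) (p q : E) :
    fderiv ℝ (fderiv ℝ (fun y ↦ f y * g y * h y)) x p q =
      fderiv ℝ (fderiv ℝ f) x p q * g x * h x + f x * fderiv ℝ (fderiv ℝ g) x p q * h x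
        + f x * g x * fderiv ℝ (fderiv ℝ h) x p q
        + fderiv ℝ f x p * fderiv ℝ g x q * h x + fderiv ℝ f x q * fderiv ℝ g x p * h x
        + fderiv ℝ f x p * g x * fderiv ℝ h x q + fderiv ℝ f x q * g x * fderiv ℝ h x p
        + f x * fderiv ℝ g x p * fderiv ℝ h x q + f x * fderiv ℝ g x q * fderiv ℝ h x p := by
  have hfg : ContDiffAt ℝ 2 (fun y ↦ f y * g y) x := hf.mul hg
  have hf1 : DifferentiableAt ℝ f x := hf.differentiableAt two_ne_zero
  have hg1 : DifferentiableAt ℝ g x := hg.differentiableAt two_ne_zero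
  rw [fderiv_fderiv_mul_apply hfg hh, fderiv_fderiv_mul_apply hf hg, fderiv_mul_apply' hf1 hg1,
    fderiv_mul_apply' hf1 hg1]
  ring

/-- **Second derivative of a finite sum** of `C²` scalar functions, applied. [folklore] -/
theorem fderiv_fderiv_fun_sum_apply {α : Type*} (s : Finset α) {F : α → E → ℝ} {x : E}
    (hF : ∀ a ∈ s, ContDiffAt ℝ 2 (F a) x) (p q : E) :
    fderiv ℝ (fderiv ℝ (fun y ↦ ∑ a ∈ s, F a y)) x p q =
      ∑ a ∈ s, fderiv ℝ (fderiv ℝ (F a)) x p q := by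
  classical
  have hsum : ContDiffAt ℝ 2 (fun y ↦ ∑ a ∈ s, F a y) x := ContDiffAt.sum fun a ha ↦ hF a ha
  rw [fderiv_fderiv_apply_eq_fderiv hsum]
  have hev : (fun y ↦ fderiv ℝ (fun y ↦ ∑ a ∈ s, F a y) y q) =ᶠ[𝓝 x]
      fun y ↦ ∑ a ∈ s, fderiv ℝ (F a) y q := by
    have hall : ∀ᶠ y in 𝓝 x, ∀ a ∈ s, DifferentiableAt ℝ (F a) y :=
      (s.eventually_all).2 fun a ha ↦ eventually_differentiableAt_of_contDiffAt_two' (hF a ha)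
    filter_upwards [hall] with y hy
    rw [fderiv_fun_sum hy, FunLike.coe_sum, Finset.sum_apply]
  rw [hev.fderiv_eq, fderiv_fun_sum fun a ha ↦
    (differentiableAt_fderiv_of_contDiffAt_two' (hF a ha)).clm_apply (differentiableAt_const q),
    FunLike.coe_sum, Finset.sum_apply]
  exact Finset.sum_congr rfl fun a ha ↦ (fderiv_fderiv_apply_eq_fderiv (hF a ha) p q).symm

/-- The components `y ↦ T(y)(v, w)` of a `C^n` family of bilinear maps are `C^n`. [folklore] -/
theorem contDiffAt_apply₂ {T : E → E →L[ℝ] E →L[ℝ] ℝ} {x : E} {n : WithTop ℕ∞}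
    (hT : ContDiffAt ℝ n T x) (v w : E) : ContDiffAt ℝ n (fun y ↦ T y v w) x :=
  (hT.clm_apply contDiffAt_const).clm_apply contDiffAt_const

/-- Second derivatives of the components are components of the second derivative:
`D²[T(·)(v, w)](x)(p, q) = D²T(x)(p, q)(v, w)` (`fderiv_fderiv_bilin_apply_eq`). [folklore] -/
theorem fderiv_fderiv_apply₂ {T : E → E →L[ℝ] E →L[ℝ] ℝ} {x : E} (hT : ContDiffAt ℝ 2 T x)
    (v w p q : E) :
    fderiv ℝ (fderiv ℝ (fun y ↦ T y v w)) x p q = fderiv ℝ (fderiv ℝ T) x p q v w := by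
  rw [fderiv_fderiv_apply_eq_fderiv (contDiffAt_apply₂ hT v w), fderiv_fderiv_bilin_apply_eq hT]

end Calculus

namespace OpensChart

/-! ### The coordinate expression as a function of the data -/

section Data

variable {E : Type*} [NormedAddCommGroup E] [NormedSpace ℝ E]
  {ι : Type*} [Fintype ι] [DecidableEq ι] (b : Module.Basis ι ℝ E)

/-- **The metric pairing of two bilinear forms in coordinates**:
`⟨T, T'⟩ = gʲⁱ gᶜᵃ T(b_c, bᵢ) T'(bₐ, bⱼ) = T_{ci} T'^{ci}`, an explicit expression in an inverse
Gram matrix `Gi = (gʲⁱ)` and the two forms; for `T = T'` and `Gi` the inverse Gram matrix of a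
metric this is the metric square norm `|T|²_g` (`normSq_eq_normSqCoord`; O'Neill 1983, Ch. 3,
pp. 60–61). [cite: ONeill1983, Ch. 3, pp. 60–61] -/
def normSqCoord (Gi : Matrix ι ι ℝ) (T T' : E →L[ℝ] E →L[ℝ] ℝ) : ℝ :=
  ∑ i, ∑ j, ∑ a, ∑ c, Gi j i * Gi c a * T (b c) (b i) * T' (b a) (b j)

omit [DecidableEq ι] in
/-- `normSqCoord` is symmetric in the two forms when the inverse Gram matrix is symmetric
(reindex `(i, j, a, c) ↦ (j, i, c, a)`). [folklore] -/
theorem normSqCoord_comm {Gi : Matrix ι ι ℝ} (hGi : ∀ i j, Gi i j = Gi j i)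
    (T T' : E →L[ℝ] E →L[ℝ] ℝ) : normSqCoord b Gi T T' = normSqCoord b Gi T' T := by
  unfold normSqCoord
  rw [Finset.sum_comm]
  refine Finset.sum_congr rfl fun i _ ↦ Finset.sum_congr rfl fun j _ ↦ ?_
  rw [Finset.sum_comm]
  refine Finset.sum_congr rfl fun a _ ↦ Finset.sum_congr rfl fun c _ ↦ ?_
  rw [hGi i j, hGi a c]
  ring

omit [DecidableEq ι] in
/-- `normSqCoord` is additive in the first form. [folklore] -/
theorem normSqCoord_add_left (Gi : Matrix ι ι ℝ) (T₁ T₂ T' : E →L[ℝ] E →L[ℝ] ℝ) :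
    normSqCoord b Gi (T₁ + T₂) T' = normSqCoord b Gi T₁ T' + normSqCoord b Gi T₂ T' := by
  simp only [normSqCoord, _root_.add_apply, ← Finset.sum_add_distrib]
  refine Finset.sum_congr rfl fun i _ ↦ Finset.sum_congr rfl fun j _ ↦
    Finset.sum_congr rfl fun a _ ↦ Finset.sum_congr rfl fun c _ ↦ ?_
  ring

omit [DecidableEq ι] in
/-- `normSqCoord` is homogeneous in the first form. [folklore] -/
theorem normSqCoord_smul_left (Gi : Matrix ι ι ℝ) (r : ℝ) (T T' : E →L[ℝ] E →L[ℝ] ℝ) :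
    normSqCoord b Gi (r • T) T' = r * normSqCoord b Gi T T' := by
  simp only [normSqCoord, _root_.smul_apply, smul_eq_mul, Finset.mul_sum]
  refine Finset.sum_congr rfl fun i _ ↦ Finset.sum_congr rfl fun j _ ↦
    Finset.sum_congr rfl fun a _ ↦ Finset.sum_congr rfl fun c _ ↦ ?_
  ring

omit [DecidableEq ι] in
/-- `normSqCoord` is subtractive in the first form. [folklore] -/
theorem normSqCoord_sub_left (Gi : Matrix ι ι ℝ) (T₁ T₂ T' : E →L[ℝ] E →L[ℝ] ℝ) :
    normSqCoord b Gi (T₁ - T₂) T' = normSqCoord b Gi T₁ T' - normSqCoord b Gi T₂ T' := by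
  simp only [normSqCoord, _root_.sub_apply, ← Finset.sum_sub_distrib]
  refine Finset.sum_congr rfl fun i _ ↦ Finset.sum_congr rfl fun j _ ↦
    Finset.sum_congr rfl fun a _ ↦ Finset.sum_congr rfl fun c _ ↦ ?_
  ring

omit [DecidableEq ι] in
/-- `normSqCoord` is additive in the second form. [folklore] -/
theorem normSqCoord_add_right (Gi : Matrix ι ι ℝ) (T T₁ T₂ : E →L[ℝ] E →L[ℝ] ℝ) :
    normSqCoord b Gi T (T₁ + T₂) = normSqCoord b Gi T T₁ + normSqCoord b Gi T T₂ := by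
  simp only [normSqCoord, _root_.add_apply, ← Finset.sum_add_distrib]
  refine Finset.sum_congr rfl fun i _ ↦ Finset.sum_congr rfl fun j _ ↦
    Finset.sum_congr rfl fun a _ ↦ Finset.sum_congr rfl fun c _ ↦ ?_
  ring

omit [DecidableEq ι] in
/-- `normSqCoord` is subtractive in the second form. [folklore] -/
theorem normSqCoord_sub_right (Gi : Matrix ι ι ℝ) (T T₁ T₂ : E →L[ℝ] E →L[ℝ] ℝ) :
    normSqCoord b Gi T (T₁ - T₂) = normSqCoord b Gi T T₁ - normSqCoord b Gi T T₂ := by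
  simp only [normSqCoord, _root_.sub_apply, ← Finset.sum_sub_distrib]
  refine Finset.sum_congr rfl fun i _ ↦ Finset.sum_congr rfl fun j _ ↦
    Finset.sum_congr rfl fun a _ ↦ Finset.sum_congr rfl fun c _ ↦ ?_
  ring

/-- An explicit constant bounding the coordinate pairing: `C(Gi) = ∑ |gʲⁱ| |gᶜᵃ| ‖b_c‖ ‖bᵢ‖ ‖bₐ‖ ‖bⱼ‖`
(`abs_normSqCoord_le`). [folklore] -/
def normSqCoordBound (Gi : Matrix ι ι ℝ) : ℝ :=
  ∑ i, ∑ j, ∑ a, ∑ c, |Gi j i| * |Gi c a| * ‖b c‖ * ‖b i‖ * ‖b a‖ * ‖b j‖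

omit [DecidableEq ι] in
/-- `normSqCoordBound` is nonnegative. [folklore] -/
theorem normSqCoordBound_nonneg (Gi : Matrix ι ι ℝ) : 0 ≤ normSqCoordBound b Gi :=
  Finset.sum_nonneg fun _ _ ↦ Finset.sum_nonneg fun _ _ ↦ Finset.sum_nonneg fun _ _ ↦
    Finset.sum_nonneg fun _ _ ↦ by positivity

omit [DecidableEq ι] in
/-- **The coordinate pairing is bounded by the operator norms**:
`|⟨T, T'⟩| ≤ C(Gi) ‖T‖ ‖T'‖` with `C = normSqCoordBound` (`|T(v, w)| ≤ ‖T‖ ‖v‖ ‖w‖`). [folklore] -/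
theorem abs_normSqCoord_le (Gi : Matrix ι ι ℝ) (T T' : E →L[ℝ] E →L[ℝ] ℝ) :
    |normSqCoord b Gi T T'| ≤ normSqCoordBound b Gi * ‖T‖ * ‖T'‖ := by
  unfold normSqCoord normSqCoordBound
  rw [Finset.sum_mul, Finset.sum_mul]
  refine (Finset.abs_sum_le_sum_abs _ _).trans (Finset.sum_le_sum fun i _ ↦ ?_)
  rw [Finset.sum_mul, Finset.sum_mul]
  refine (Finset.abs_sum_le_sum_abs _ _).trans (Finset.sum_le_sum fun j _ ↦ ?_)
  rw [Finset.sum_mul, Finset.sum_mul]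
  refine (Finset.abs_sum_le_sum_abs _ _).trans (Finset.sum_le_sum fun a _ ↦ ?_)
  rw [Finset.sum_mul, Finset.sum_mul]
  refine (Finset.abs_sum_le_sum_abs _ _).trans (Finset.sum_le_sum fun c _ ↦ ?_)
  have hT : |T (b c) (b i)| ≤ ‖T‖ * ‖b c‖ * ‖b i‖ := by
    rw [← Real.norm_eq_abs]
    exact (T (b c)).le_of_opNorm_le (T.le_opNorm (b c)) (b i)
  have hT' : |T' (b a) (b j)| ≤ ‖T'‖ * ‖b a‖ * ‖b j‖ := by
    rw [← Real.norm_eq_abs]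
    exact (T' (b a)).le_of_opNorm_le (T'.le_opNorm (b a)) (b j)
  rw [abs_mul, abs_mul, abs_mul]
  have h1 : 0 ≤ |Gi j i| * |Gi c a| := by positivity
  calc |Gi j i| * |Gi c a| * |T (b c) (b i)| * |T' (b a) (b j)|
      ≤ |Gi j i| * |Gi c a| * (‖T‖ * ‖b c‖ * ‖b i‖) * (‖T'‖ * ‖b a‖ * ‖b j‖) := by
        gcongr
    _ = |Gi j i| * |Gi c a| * ‖b c‖ * ‖b i‖ * ‖b a‖ * ‖b j‖ * ‖T‖ * ‖T'‖ := by ring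

omit [DecidableEq ι] in
/-- Homogeneity: `⟨r T, r T⟩ = r² ⟨T, T⟩`. [folklore] -/
theorem normSqCoord_smul_smul (Gi : Matrix ι ι ℝ) (r : ℝ) (T : E →L[ℝ] E →L[ℝ] ℝ) :
    normSqCoord b Gi (r • T) (r • T) = r ^ 2 * normSqCoord b Gi T T := by
  simp only [normSqCoord, _root_.smul_apply, smul_eq_mul, Finset.mul_sum]
  refine Finset.sum_congr rfl fun i _ ↦ Finset.sum_congr rfl fun j _ ↦
    Finset.sum_congr rfl fun a _ ↦ Finset.sum_congr rfl fun c _ ↦ ?_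
  ring

/-- The coordinate pairing with an arbitrary weight array `wt`:
`wsum wt T T' = ∑ wt(i,j,a,c) T(b_c, bᵢ) T'(bₐ, bⱼ)`; `normSqCoord Gi = wsum (gʲⁱ gᶜᵃ)`
(`normSqCoord_eq_wsum`). Used to expand derivatives of `y ↦ ⟨H(y), H(y)⟩_{h(y)}`, whose weights
depend on the point. [folklore] -/
def wsum (wt : ι → ι → ι → ι → ℝ) (T T' : E →L[ℝ] E →L[ℝ] ℝ) : ℝ :=
  ∑ i, ∑ j, ∑ a, ∑ c, wt i j a c * T (b c) (b i) * T' (b a) (b j)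

omit [DecidableEq ι] in
/-- `normSqCoord` is `wsum` with the weights `gʲⁱ gᶜᵃ`. [folklore] -/
theorem normSqCoord_eq_wsum (Gi : Matrix ι ι ℝ) (T T' : E →L[ℝ] E →L[ℝ] ℝ) :
    normSqCoord b Gi T T' = wsum b (fun i j a c ↦ Gi j i * Gi c a) T T' := rfl

/-- An explicit constant bounding `wsum`: `∑ |wt(i,j,a,c)| ‖b_c‖ ‖bᵢ‖ ‖bₐ‖ ‖bⱼ‖`. [folklore] -/
def wsumBound (wt : ι → ι → ι → ι → ℝ) : ℝ :=
  ∑ i, ∑ j, ∑ a, ∑ c, |wt i j a c| * ‖b c‖ * ‖b i‖ * ‖b a‖ * ‖b j‖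

omit [DecidableEq ι] in
/-- `wsumBound` is nonnegative. [folklore] -/
theorem wsumBound_nonneg (wt : ι → ι → ι → ι → ℝ) : 0 ≤ wsumBound b wt :=
  Finset.sum_nonneg fun _ _ ↦ Finset.sum_nonneg fun _ _ ↦ Finset.sum_nonneg fun _ _ ↦
    Finset.sum_nonneg fun _ _ ↦ by positivity

omit [DecidableEq ι] in
/-- **`wsum` is bounded by the operator norms**: `|wsum wt T T'| ≤ wsumBound wt ‖T‖ ‖T'‖`.
[folklore] -/
theorem abs_wsum_le (wt : ι → ι → ι → ι → ℝ) (T T' : E →L[ℝ] E →L[ℝ] ℝ) :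
    |wsum b wt T T'| ≤ wsumBound b wt * ‖T‖ * ‖T'‖ := by
  unfold wsum wsumBound
  rw [Finset.sum_mul, Finset.sum_mul]
  refine (Finset.abs_sum_le_sum_abs _ _).trans (Finset.sum_le_sum fun i _ ↦ ?_)
  rw [Finset.sum_mul, Finset.sum_mul]
  refine (Finset.abs_sum_le_sum_abs _ _).trans (Finset.sum_le_sum fun j _ ↦ ?_)
  rw [Finset.sum_mul, Finset.sum_mul]
  refine (Finset.abs_sum_le_sum_abs _ _).trans (Finset.sum_le_sum fun a _ ↦ ?_)
  rw [Finset.sum_mul, Finset.sum_mul]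
  refine (Finset.abs_sum_le_sum_abs _ _).trans (Finset.sum_le_sum fun c _ ↦ ?_)
  have hT : |T (b c) (b i)| ≤ ‖T‖ * ‖b c‖ * ‖b i‖ := by
    rw [← Real.norm_eq_abs]
    exact (T (b c)).le_of_opNorm_le (T.le_opNorm (b c)) (b i)
  have hT' : |T' (b a) (b j)| ≤ ‖T'‖ * ‖b a‖ * ‖b j‖ := by
    rw [← Real.norm_eq_abs]
    exact (T' (b a)).le_of_opNorm_le (T'.le_opNorm (b a)) (b j)
  rw [abs_mul, abs_mul]
  calc |wt i j a c| * |T (b c) (b i)| * |T' (b a) (b j)|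
      ≤ |wt i j a c| * (‖T‖ * ‖b c‖ * ‖b i‖) * (‖T'‖ * ‖b a‖ * ‖b j‖) := by gcongr
    _ = |wt i j a c| * ‖b c‖ * ‖b i‖ * ‖b a‖ * ‖b j‖ * ‖T‖ * ‖T'‖ := by ring

omit [DecidableEq ι] in
/-- `wsum` is additive in the first form. [folklore] -/
theorem wsum_add_left (wt : ι → ι → ι → ι → ℝ) (T₁ T₂ T' : E →L[ℝ] E →L[ℝ] ℝ) :
    wsum b wt (T₁ + T₂) T' = wsum b wt T₁ T' + wsum b wt T₂ T' := by
  simp only [wsum, _root_.add_apply, ← Finset.sum_add_distrib]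
  refine Finset.sum_congr rfl fun i _ ↦ Finset.sum_congr rfl fun j _ ↦
    Finset.sum_congr rfl fun a _ ↦ Finset.sum_congr rfl fun c _ ↦ ?_
  ring

omit [DecidableEq ι] in
/-- `wsum` is subtractive in the first form. [folklore] -/
theorem wsum_sub_left (wt : ι → ι → ι → ι → ℝ) (T₁ T₂ T' : E →L[ℝ] E →L[ℝ] ℝ) :
    wsum b wt (T₁ - T₂) T' = wsum b wt T₁ T' - wsum b wt T₂ T' := by
  simp only [wsum, _root_.sub_apply, ← Finset.sum_sub_distrib]
  refine Finset.sum_congr rfl fun i _ ↦ Finset.sum_congr rfl fun j _ ↦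
    Finset.sum_congr rfl fun a _ ↦ Finset.sum_congr rfl fun c _ ↦ ?_
  ring

omit [DecidableEq ι] in
/-- `wsum` is additive in the second form. [folklore] -/
theorem wsum_add_right (wt : ι → ι → ι → ι → ℝ) (T T₁ T₂ : E →L[ℝ] E →L[ℝ] ℝ) :
    wsum b wt T (T₁ + T₂) = wsum b wt T T₁ + wsum b wt T T₂ := by
  simp only [wsum, _root_.add_apply, ← Finset.sum_add_distrib]
  refine Finset.sum_congr rfl fun i _ ↦ Finset.sum_congr rfl fun j _ ↦
    Finset.sum_congr rfl fun a _ ↦ Finset.sum_congr rfl fun c _ ↦ ?_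
  ring

omit [DecidableEq ι] in
/-- `wsum` is subtractive in the second form. [folklore] -/
theorem wsum_sub_right (wt : ι → ι → ι → ι → ℝ) (T T₁ T₂ : E →L[ℝ] E →L[ℝ] ℝ) :
    wsum b wt T (T₁ - T₂) = wsum b wt T T₁ - wsum b wt T T₂ := by
  simp only [wsum, _root_.sub_apply, ← Finset.sum_sub_distrib]
  refine Finset.sum_congr rfl fun i _ ↦ Finset.sum_congr rfl fun j _ ↦
    Finset.sum_congr rfl fun a _ ↦ Finset.sum_congr rfl fun c _ ↦ ?_
  ring

omit [DecidableEq ι] in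
/-- `wsum` is homogeneous in the first form. [folklore] -/
theorem wsum_smul_left (wt : ι → ι → ι → ι → ℝ) (r : ℝ) (T T' : E →L[ℝ] E →L[ℝ] ℝ) :
    wsum b wt (r • T) T' = r * wsum b wt T T' := by
  simp only [wsum, _root_.smul_apply, smul_eq_mul, Finset.mul_sum]
  refine Finset.sum_congr rfl fun i _ ↦ Finset.sum_congr rfl fun j _ ↦
    Finset.sum_congr rfl fun a _ ↦ Finset.sum_congr rfl fun c _ ↦ ?_
  ring

omit [DecidableEq ι] in
/-- **Second derivative of the square norm with variable weights.** For weights `wt(y)` and forms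
`H(y)` of class `C²` at `x`, the second derivative of `y ↦ wsum (wt y) (H y) (H y)` at `x` is the
sum of: the two terms with `D²H` (`⟨D²H(p,q), H⟩ + ⟨H, D²H(p,q)⟩`), the two first-order "good"
terms `⟨DH(p), DH(q)⟩ + ⟨DH(q), DH(p)⟩`, and five terms in which at least one derivative falls
on the weights (Leibniz rule for the triple products `wt · H(b_c,bᵢ) · H(bₐ,bⱼ)`). [folklore] -/
theorem fderiv_fderiv_wsum_apply {wf : E → ι → ι → ι → ι → ℝ} {Hf : E → E →L[ℝ] E →L[ℝ] ℝ}
    {x : E} (hw : ∀ i j a c, ContDiffAt ℝ 2 (fun y ↦ wf y i j a c) x)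
    (hH : ContDiffAt ℝ 2 Hf x) (p q : E) :
    fderiv ℝ (fderiv ℝ (fun y ↦ wsum b (wf y) (Hf y) (Hf y))) x p q =
      wsum b (wf x) (fderiv ℝ (fderiv ℝ Hf) x p q) (Hf x)
        + wsum b (wf x) (Hf x) (fderiv ℝ (fderiv ℝ Hf) x p q)
        + wsum b (wf x) (fderiv ℝ Hf x p) (fderiv ℝ Hf x q)
        + wsum b (wf x) (fderiv ℝ Hf x q) (fderiv ℝ Hf x p)
        + wsum b (fun i j a c ↦ fderiv ℝ (fderiv ℝ (fun y ↦ wf y i j a c)) x p q) (Hf x) (Hf x)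
        + wsum b (fun i j a c ↦ fderiv ℝ (fun y ↦ wf y i j a c) x p) (fderiv ℝ Hf x q) (Hf x)
        + wsum b (fun i j a c ↦ fderiv ℝ (fun y ↦ wf y i j a c) x q) (fderiv ℝ Hf x p) (Hf x)
        + wsum b (fun i j a c ↦ fderiv ℝ (fun y ↦ wf y i j a c) x p) (Hf x) (fderiv ℝ Hf x q)
        + wsum b (fun i j a c ↦ fderiv ℝ (fun y ↦ wf y i j a c) x q) (Hf x)
            (fderiv ℝ Hf x p) := by
  have hHd : DifferentiableAt ℝ Hf x := hH.differentiableAt two_ne_zero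
  have hm : ∀ v w, ContDiffAt ℝ 2 (fun y ↦ Hf y v w) x := fun v w ↦ contDiffAt_apply₂ hH v w
  have hterm : ∀ i j a c, ContDiffAt ℝ 2
      (fun y ↦ wf y i j a c * Hf y (b c) (b i) * Hf y (b a) (b j)) x := fun i j a c ↦
    ((hw i j a c).mul (hm _ _)).mul (hm _ _)
  -- expand the nested sums
  have h1 : fderiv ℝ (fderiv ℝ (fun y ↦ wsum b (wf y) (Hf y) (Hf y))) x p q =
      ∑ i, ∑ j, ∑ a, ∑ c, fderiv ℝ (fderiv ℝ
        (fun y ↦ wf y i j a c * Hf y (b c) (b i) * Hf y (b a) (b j))) x p q := by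
    unfold wsum
    rw [fderiv_fderiv_fun_sum_apply _ (fun i _ ↦ ContDiffAt.sum fun j _ ↦
      ContDiffAt.sum fun a _ ↦ ContDiffAt.sum fun c _ ↦ hterm i j a c)]
    refine Finset.sum_congr rfl fun i _ ↦ ?_
    rw [fderiv_fderiv_fun_sum_apply _ (fun j _ ↦
      ContDiffAt.sum fun a _ ↦ ContDiffAt.sum fun c _ ↦ hterm i j a c)]
    refine Finset.sum_congr rfl fun j _ ↦ ?_
    rw [fderiv_fderiv_fun_sum_apply _ (fun a _ ↦ ContDiffAt.sum fun c _ ↦ hterm i j a c)]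
    refine Finset.sum_congr rfl fun a _ ↦ ?_
    rw [fderiv_fderiv_fun_sum_apply _ (fun c _ ↦ hterm i j a c)]
  rw [h1]
  simp only [wsum, ← Finset.sum_add_distrib]
  refine Finset.sum_congr rfl fun i _ ↦ Finset.sum_congr rfl fun j _ ↦
    Finset.sum_congr rfl fun a _ ↦ Finset.sum_congr rfl fun c _ ↦ ?_
  rw [fderiv_fderiv_mul_mul_apply (hw i j a c) (hm _ _) (hm _ _),
    fderiv_fderiv_apply₂ hH, fderiv_fderiv_apply₂ hH,
    fderiv_apply₂ Hf hHd, fderiv_apply₂ Hf hHd, fderiv_apply₂ Hf hHd, fderiv_apply₂ Hf hHd]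
  ring

omit [DecidableEq ι] in
/-- **Time derivative of the square norm along a family of forms**: if the components
`s ↦ T_s(bᵢ, bⱼ)` have derivatives `T'(bᵢ, bⱼ)` within `S` at `t`, then
`d/ds ⟨T_s, T_s⟩ = 2 ⟨T', T_t⟩` (for a symmetric inverse Gram matrix; product rule termwise).
[folklore] -/
theorem hasDerivWithinAt_normSqCoord {Gi : Matrix ι ι ℝ} (hGi : ∀ i j, Gi i j = Gi j i)
    {T : ℝ → E →L[ℝ] E →L[ℝ] ℝ} {T' : E →L[ℝ] E →L[ℝ] ℝ} {S : Set ℝ} {t : ℝ}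
    (hT : ∀ i j, HasDerivWithinAt (fun s ↦ T s (b i) (b j)) (T' (b i) (b j)) S t) :
    HasDerivWithinAt (fun s ↦ normSqCoord b Gi (T s) (T s))
      (2 * normSqCoord b Gi T' (T t)) S t := by
  have hsum : HasDerivWithinAt (fun s ↦ normSqCoord b Gi (T s) (T s))
      (∑ i, ∑ j, ∑ a, ∑ c, (Gi j i * Gi c a * T' (b c) (b i) * T t (b a) (b j)
        + Gi j i * Gi c a * T t (b c) (b i) * T' (b a) (b j))) S t := by
    unfold normSqCoord
    refine HasDerivWithinAt.fun_sum fun i _ ↦ HasDerivWithinAt.fun_sum fun j _ ↦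
      HasDerivWithinAt.fun_sum fun a _ ↦ HasDerivWithinAt.fun_sum fun c _ ↦ ?_
    have h := ((hT c i).const_mul (Gi j i * Gi c a)).mul (hT a j)
    have hfun : (fun s ↦ Gi j i * Gi c a * T s (b c) (b i) * T s (b a) (b j)) =
        (fun y ↦ Gi j i * Gi c a * T y (b c) (b i)) * fun s ↦ T s (b a) (b j) := by
      funext s
      simp only [Pi.mul_apply]
    rw [hfun]
    exact h.congr_deriv (by ring)
  refine hsum.congr_deriv ?_
  rw [two_mul]
  nth_rewrite 2 [normSqCoord_comm b hGi T' (T t)]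
  simp only [normSqCoord]
  rw [← Finset.sum_add_distrib]
  refine Finset.sum_congr rfl fun i _ ↦ ?_
  rw [← Finset.sum_add_distrib]
  refine Finset.sum_congr rfl fun j _ ↦ ?_
  rw [← Finset.sum_add_distrib]
  refine Finset.sum_congr rfl fun a _ ↦ ?_
  rw [← Finset.sum_add_distrib]

end Data

/-! ### Identification with the metric square norm on `U : Opens E` -/

section Ident

variable {E : Type*} [NormedAddCommGroup E] [NormedSpace ℝ E] [FiniteDimensional ℝ E]
  {U : Opens E}
  {h : PseudoRiemannianMetric 𝓘(ℝ, E) ∞ E (TangentSpace 𝓘(ℝ, E) : U → Type _)}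
  {Hr : E → E →L[ℝ] E →L[ℝ] ℝ} (hH : ∀ y : U, h.val y = Hr y)
  {ι : Type*} [Fintype ι] [DecidableEq ι] (b : Module.Basis ι ℝ E)

omit hH in
/-- A continuous bilinear map on `E` regarded as a bilinear form on the tangent space `T_x U = E`
(instance-path copy, cf. `basisT`). [folklore] -/
def bilinT (x : U) (Tc : E →L[ℝ] E →L[ℝ] ℝ) : LinearMap.BilinForm ℝ (TangentSpace 𝓘(ℝ, E) x) :=
  (Tc.toLinearMap₁₂ : LinearMap.BilinForm ℝ E)

omit [FiniteDimensional ℝ E] in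
/-- `bilinT x Tc v w = Tc v w`. [folklore] -/
@[simp]
theorem bilinT_apply (x : U) (Tc : E →L[ℝ] E →L[ℝ] ℝ) (v w : E) :
    bilinT x Tc v w = Tc v w := rfl

include hH

/-- **The metric square norm is `normSqCoord` of the components**: for a bilinear form `T` on
`T_x U` with values `T v w = Tc v w`, `|T|²_h(x) = normSqCoord b (h⁻¹(x)) Tc Tc` with
`h⁻¹(x) = gramInv b (Hr x)` (`normSq_eq_sum_gram_inv` in the basis `b`).
[cite: ONeill1983, Ch. 3, pp. 60–61] -/
theorem normSq_eq_normSqCoord (x : U) (T : LinearMap.BilinForm ℝ (TangentSpace 𝓘(ℝ, E) x))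
    (Tc : E →L[ℝ] E →L[ℝ] ℝ) (hT : ∀ v w, T v w = Tc v w) :
    h.normSq x T = normSqCoord b (gramInv b (Hr x)) Tc Tc := by
  rw [normSq_eq_sum_gram_inv h x (basisT b x), gram_inv_eq_gramInv hH b x, normSqCoord]
  simp only [basisT_apply, hT]

/-- For a metric positive definite at `x`, `normSqCoord b (h⁻¹(x)) Tc Tc ≥ 0`.
[cite: ONeill1983, Ch. 3, pp. 60–61] -/
theorem normSqCoord_self_nonneg (hpos : h.IsRiemannian) (x : U) (Tc : E →L[ℝ] E →L[ℝ] ℝ) :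
    0 ≤ normSqCoord b (gramInv b (Hr x)) Tc Tc := by
  rw [← normSq_eq_normSqCoord hH b x (bilinT x Tc) Tc (fun v w ↦ rfl)]
  exact h.normSq_nonneg x hpos _

/-- For a metric positive definite at `x`, `normSqCoord b (h⁻¹(x)) Tc Tc > 0` unless `Tc = 0`.
[cite: ONeill1983, Ch. 3, pp. 60–61] -/
theorem normSqCoord_self_pos (hpos : h.IsRiemannian) (x : U) {Tc : E →L[ℝ] E →L[ℝ] ℝ}
    (hTc : Tc ≠ 0) : 0 < normSqCoord b (gramInv b (Hr x)) Tc Tc := by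
  rw [← normSq_eq_normSqCoord hH b x (bilinT x Tc) Tc (fun v w ↦ rfl)]
  refine h.normSq_pos x hpos fun h0 ↦ hTc ?_
  ext v w
  have := LinearMap.congr_fun₂ h0 v w
  simpa using this

omit [FiniteDimensional ℝ E] in
/-- The inverse Gram entries of the components of a smooth metric on `U` are continuous on `U`
(as functions on `E`, at the points of `U`). [folklore] -/
theorem continuousAt_gramInv_repr (y : U) (j i : ι) :
    ContinuousAt (fun z : E ↦ gramInv b (Hr z) j i) y :=
  (differentiableAt_gramInv_apply b ((contDiffAt_repr hH y).of_le (by exact_mod_cast le_top))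
    (det_gram_repr_ne_zero hH b y) j i).continuousAt

/-- **Uniform coercivity of the square norm over a compact set.** For a Riemannian metric `h`
on `U` and a compact `K ⊆ U` there is `μ > 0` with `μ ‖T‖² ≤ ⟨T, T⟩_{h(y)} =
normSqCoord b (h⁻¹(y)) T T` for all `y ∈ K` and all `T` (continuity and positivity of
`(y, T) ↦ ⟨T, T⟩_{h(y)}` on the compact `K × {‖T‖ = 1}`, homogeneity). [folklore] -/
theorem exists_pos_mul_norm_sq_le_normSqCoord (hpos : h.IsRiemannian) {K : Set E}
    (hK : IsCompact K) (hKU : K ⊆ (U : Set E)) :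
    ∃ μ : ℝ, 0 < μ ∧ ∀ y ∈ K, ∀ T : E →L[ℝ] E →L[ℝ] ℝ,
      μ * ‖T‖ ^ 2 ≤ normSqCoord b (gramInv b (Hr y)) T T := by
  set f : E × (E →L[ℝ] E →L[ℝ] ℝ) → ℝ := fun p ↦ normSqCoord b (gramInv b (Hr p.1)) p.2 p.2
    with hf
  set Ks : Set (E × (E →L[ℝ] E →L[ℝ] ℝ)) := K ×ˢ Metric.sphere 0 1 with hKs
  have hKsc : IsCompact Ks := hK.prod (isCompact_sphere 0 1)
  -- continuity of `f` on `Ks`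
  have hfc : ContinuousOn f Ks := by
    have hGi : ∀ j i, ContinuousOn (fun p : E × (E →L[ℝ] E →L[ℝ] ℝ) ↦ gramInv b (Hr p.1) j i)
        Ks := fun j i p hp ↦
      (ContinuousAt.comp (f := Prod.fst) (g := fun z : E ↦ gramInv b (Hr z) j i) (x := p)
        (continuousAt_gramInv_repr hH b ⟨p.1, hKU hp.1⟩ j i) continuousAt_fst).continuousWithinAt
    have hTa : ∀ v w : E, ContinuousOn (fun p : E × (E →L[ℝ] E →L[ℝ] ℝ) ↦ p.2 v w) Ks :=
      fun v w ↦ ((ContinuousLinearMap.apply ℝ _ w).continuous.comp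
        ((ContinuousLinearMap.apply ℝ _ v).continuous.comp continuous_snd)).continuousOn
    simp only [hf, normSqCoord]
    refine continuousOn_finsetSum _ fun i _ ↦ continuousOn_finsetSum _ fun j _ ↦
      continuousOn_finsetSum _ fun a _ ↦ continuousOn_finsetSum _ fun c _ ↦ ?_
    exact (((hGi j i).mul (hGi c a)).mul (hTa (b c) (b i))).mul (hTa (b a) (b j))
  -- positivity of `f` on `Ks`
  have hfpos : ∀ p ∈ Ks, 0 < f p := by
    rintro ⟨y, T⟩ ⟨hy, hT⟩
    have hT0 : T ≠ 0 := by
      intro h0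
      rw [h0, mem_sphere_zero_iff_norm, norm_zero] at hT
      exact zero_ne_one hT
    exact normSqCoord_self_pos hH b hpos ⟨y, hKU hy⟩ hT0
  by_cases hne : Ks.Nonempty
  · obtain ⟨p₀, hp₀, hmin⟩ := hKsc.exists_isMinOn hne hfc
    refine ⟨f p₀, hfpos p₀ hp₀, fun y hy T ↦ ?_⟩
    by_cases hT : T = 0
    · subst hT
      rw [norm_zero, zero_pow two_ne_zero, mul_zero]
      exact normSqCoord_self_nonneg hH b hpos ⟨y, hKU hy⟩ 0
    · have hTn : 0 < ‖T‖ := norm_pos_iff.2 hT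
      set T₁ : E →L[ℝ] E →L[ℝ] ℝ := ‖T‖⁻¹ • T with hT₁
      have hT₁s : T₁ ∈ Metric.sphere (0 : E →L[ℝ] E →L[ℝ] ℝ) 1 := by
        rw [mem_sphere_zero_iff_norm, hT₁, norm_smul, norm_inv, norm_norm,
          inv_mul_cancel₀ hTn.ne']
      have h1 : f p₀ ≤ f (y, T₁) := hmin ⟨hy, hT₁s⟩
      have h2 : f (y, T₁) = ‖T‖⁻¹ ^ 2 * normSqCoord b (gramInv b (Hr y)) T T := by
        simp only [hf, hT₁]
        exact normSqCoord_smul_smul b _ _ _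
      rw [h2] at h1
      have h3 : f p₀ * ‖T‖ ^ 2 ≤ ‖T‖⁻¹ ^ 2 * normSqCoord b (gramInv b (Hr y)) T T * ‖T‖ ^ 2 :=
        mul_le_mul_of_nonneg_right h1 (by positivity)
      calc f p₀ * ‖T‖ ^ 2 ≤ ‖T‖⁻¹ ^ 2 * normSqCoord b (gramInv b (Hr y)) T T * ‖T‖ ^ 2 := h3
        _ = normSqCoord b (gramInv b (Hr y)) T T := by
          field_simp
  · refine ⟨1, one_pos, fun y hy T ↦ ?_⟩
    by_cases hT : T = 0
    · subst hT
      rw [norm_zero, zero_pow two_ne_zero, mul_zero]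
      exact normSqCoord_self_nonneg hH b hpos ⟨y, hKU hy⟩ 0
    · exfalso
      apply hne
      have hTn : 0 < ‖T‖ := norm_pos_iff.2 hT
      refine ⟨(y, ‖T‖⁻¹ • T), hy, ?_⟩
      rw [mem_sphere_zero_iff_norm, norm_smul, norm_inv, norm_norm, inv_mul_cancel₀ hTn.ne']

end Ident

end OpensChart


end Literature.Geometry.Riemannian

end
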